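import Literature.Analysis.FluidPDE.LocalPressureFarFieldTools
import HarnessLib

/-!
# The pressure of a compactly supported field: Newtonian representation and far-field decay

Analysis/FluidPDE support file (serves the formalisation of Scheffer's construction of singular
weak solutions of the Navier–Stokes inequality in the presentation of W. S. Ożański,
arXiv:1709.00602, §3.2: the pressure function `p(x) = ∫ Σᵢⱼ ∂ᵢuⱼ(y)∂ⱼuᵢ(y)/(4π|x-y|) dy`
((3.3)) of a field `u ∈ C_c^∞(ℝ³)`, its decay `|∇p(x)| ≤ C|x|⁻⁴` ((3.4)) and the far-field
computations behind (3.5) and Lemma 7; and the discharge of the switching argument, fact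
`Literature.Barriers.NavierStokesRegularity.NSISwitching`, where the pressure of compactly
supported slices has to be controlled).

For the tree's normalised pressure `p̃[v] = normalisedPressure v` (`-Δ⁻¹∂ᵢ∂ⱼ(vᵢvⱼ)`, realised by
the principal value; equal to the pressure potential `Q[v] = -Γ₀ * G[v] - (D²Γ∞) * (v ⊗ v)` of
`PressureRepresentation` for `v ∈ C²` with `|v|² ∈ L¹`, `G[v] = ∂ᵢ∂ⱼ(vᵢvⱼ) = pressureSource v`)
and a field `v` supported in the closed ball `B̄(0, R)` we prove:

* `pressureSource_apply_eq_zero_of_notMem_tsupport` — `G[v] = 0` off `supp v` (any `E`; the `ℝ³` case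
  is the tree's `pressureSource_eq_zero_of_notMem_tsupport` of `NormalisedPressureCompactSupport`);
* `integral_fderiv2_newtonFar_eq_integral_newtonFar_mul_pressureSource` — the double
  integration by parts `∫ D²Γ∞(x-y)(v y, v y) dy = ∫ Γ∞(x-y) G[v](y) dy` with the compact support
  on the FIELD (the accepted `integral_comp_sub_mul_pressureSource` has it on the kernel);
* **`normalisedPressure_eq_integral_newton`** — the global Newtonian representation
  `p̃[v](x) = ∫ G[v](y)/(4π|x-y|) dy` for `v ∈ C_c^4` (Ożański 2017, (3.3); Scheffer 1985, (1.4):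
  `p = -Γ * ∂ᵢ∂ⱼ(vᵢvⱼ)`, `Γ = -1/(4π|x|)`), i.e. the tree's `p̃` IS the printed pressure function;
* `normalisedPressure_eq_integral_pressureKernel` — outside `B̄(0, R+2)` no principal value is
  needed: `p̃[v](x) = ∫ K(x-y)(v y) dy`, `K(z)(a) = (3⟨z,a⟩² - |a|²|z|²)/(4π|z|⁵)`;
* `abs_normalisedPressure_le_of_lt_norm` — `|p̃[v](x)| ≤ ‖v‖₂²/(π(|x|-R)³)` for `|x| > R + 2`;
* `fderiv_normalisedPressure_apply_of_lt_norm`, `exists_norm_fderiv_normalisedPressure_le` — the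
  gradient `∇p̃[v](x) = -∫ D³Γ(x-y)(·, v y, v y) dy` and its decay
  `|∇p̃[v](x)| ≤ C ‖v‖₂²/(|x|-R)⁴` for `|x| > R + 2`, `C` an absolute constant (Ożański 2017,
  (3.4), first half).

## Mathlib search

`Filter.EventuallyEq.fderiv`, `Filter.EventuallyEq.eq_of_nhds`, `norm_integral_le_of_norm_le`,
`HasCompactSupport.intro` (used); the Newtonian kernel, its derivatives and homogeneity are the
tree's `FluidPDE/NewtonKernel`, the potentials `FluidPDE/PressureRepresentation`, the bound
`‖D³Γ(z)‖ ≤ M|z|⁻⁴` is `exists_norm_fderiv3_newtonKernel_le` (`LocalPressureFarFieldTools`).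

## References

* W. S. Ożański, *On weak solutions to the Navier–Stokes inequality with internal
  singularities*, arXiv:1709.00602 (2017), §3.2 (3.3)–(3.4). [`Ozanski2017NSISingular`]
* V. Scheffer, *A solution to the Navier–Stokes inequality with an internal singularity*,
  Comm. Math. Phys. 101 (1985), (1.4). [`Scheffer1985`]
* D. Gilbarg, N. S. Trudinger, *Elliptic partial differential equations of second order* (2001),
  Lemma 4.2, (2.13). [`GilbargTrudinger2001`]
-/

noncomputable section

open MeasureTheory Set Filter Metric Topology Function Real InnerProductSpace
open scoped RealInnerProductSpace ContDiff ENNReal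

namespace Literature.Analysis.FluidPDE

/-! ### The quadratic source vanishes off the support -/

section Source

variable {E : Type*} [NormedAddCommGroup E] [InnerProductSpace ℝ E] [FiniteDimensional ℝ E]

omit [FiniteDimensional ℝ E] in
/-- The vector field `W[v] = (v·∇)v + (div v) v` behind `G[v] = div W[v]` is supported in
`supp v`. [folklore] -/
theorem tsupport_convect_add_divergence_smul_subset (v : E → E) :
    tsupport (fun y => FluidPDE.convect v v y + VectorCalculus.divergence v y • v y) ⊆
      tsupport v := by
  refine closure_mono fun y hy => ?_
  rw [mem_support] at hy ⊢
  contrapose! hy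
  simp [FluidPDE.convect_apply, hy]

omit [FiniteDimensional ℝ E] in
/-- **`G[v] = ∂ᵢ∂ⱼ(vᵢvⱼ) = 0` off the support of `v`** (any finite-dimensional `E`; the `ℝ³`
instance is the tree's `pressureSource_eq_zero_of_notMem_tsupport`). [folklore] -/
theorem pressureSource_apply_eq_zero_of_notMem_tsupport {v : E → E} {x : E} (hx : x ∉ tsupport v) :
    pressureSource v x = 0 :=
  FluidPDE.divergence_eq_zero_of_notMem_tsupport fun h =>
    hx (tsupport_convect_add_divergence_smul_subset v h)

omit [FiniteDimensional ℝ E] in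
/-- `G[v]` is supported in `supp v`. [folklore] -/
theorem tsupport_pressureSource_subset (v : E → E) : tsupport (pressureSource v) ⊆ tsupport v := by
  refine closure_minimal (fun y hy => ?_) (isClosed_tsupport v)
  rw [mem_support] at hy
  contrapose! hy
  exact pressureSource_apply_eq_zero_of_notMem_tsupport hy

variable [MeasurableSpace E] [BorelSpace E]

/-- **Double integration by parts, compact support on the field**: for `θ ∈ C²(E)` and
`v ∈ C²_c(E; E)`, `∫ θ ∂ᵢ∂ⱼ(vᵢvⱼ) = ∫ ∂ᵢ∂ⱼθ vᵢvⱼ`, i.e. `∫ θ G[v] = ∫ D²θ(y)(v y, v y) dy`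
(Leray 1934, §6 (1.11) twice; the boundary terms vanish because `v` has compact support — the
accepted `integral_mul_pressureSource` is the variant with `θ` compactly supported). [folklore] -/
theorem integral_mul_pressureSource_of_hasCompactSupport {θ : E → ℝ} {v : E → E}
    (hθ : ContDiff ℝ 2 θ) (hv : ContDiff ℝ 2 v) (hc : HasCompactSupport v) :
    ∫ y, θ y * pressureSource v y = ∫ y, fderiv ℝ (fderiv ℝ θ) y (v y) (v y) := by
  haveI : CompleteSpace E := FiniteDimensional.complete ℝ E
  have hθ1 : ContDiff ℝ 1 θ := hθ.of_le one_le_two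
  have hv1 : ContDiff ℝ 1 v := hv.of_le one_le_two
  have hv2 : ContDiff ℝ ((1 : ℕ∞) + 1) v := by exact_mod_cast hv
  have hDθ : ContDiff ℝ 1 (fderiv ℝ θ) := hθ.fderiv_right (m := 1) le_rfl
  have hK : IsCompact (tsupport v) := hc
  have hv0 : ∀ y ∉ tsupport v, v y = 0 := fun y hy => image_eq_zero_of_notMem_tsupport hy
  -- the vector field `W = (v·∇)v + (div v) v` and the scalar `β = Dθ(v)`
  set W : E → E := fun y => FluidPDE.convect v v y + VectorCalculus.divergence v y • v y with hW_def
  have hW : ContDiff ℝ 1 W :=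
    (contDiff_convect_self hv2).add ((FluidPDE.contDiff_divergence hv2).smul hv1)
  have hW0 : ∀ y ∉ tsupport v, W y = 0 := fun y hy => by
    simp [hW_def, FluidPDE.convect_apply, hv0 y hy]
  have hWc : HasCompactSupport W := HasCompactSupport.intro hK hW0
  set β : E → ℝ := fun y => fderiv ℝ θ y (v y) with hβ_def
  have hβ : ContDiff ℝ 1 β := hDθ.clm_apply hv1
  have hβvc : HasCompactSupport fun y => β y • v y := hc.smul_left
  -- first integration by parts (compact support on `W`)
  have h1 := FluidPDE.integral_mul_divergence_add_eq_zero_right hθ1 hW hWc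
  -- second integration by parts: `∫ div(β v) = 0`
  have h2 := FluidPDE.integral_divergence_eq_zero (w := fun y => β y • v y) (hβ.smul hv1) hβvc
  -- pointwise identities
  have hgradθ : ∀ y, ⟪W y, gradient θ y⟫ =
      fderiv ℝ θ y (FluidPDE.convect v v y) + VectorCalculus.divergence v y * β y := fun y => by
    rw [FluidPDE.inner_gradient_eq_fderiv_apply]
    simp [hW_def, hβ_def]
  have hdivβ : ∀ y, VectorCalculus.divergence (fun y => β y • v y) y =
      ⟪W y, gradient θ y⟫ + fderiv ℝ (fderiv ℝ θ) y (v y) (v y) := fun y => by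
    have hβd : DifferentiableAt ℝ β y := hβ.differentiable one_ne_zero y
    have hvd : DifferentiableAt ℝ v y := hv1.differentiable one_ne_zero y
    have hDθd : DifferentiableAt ℝ (fderiv ℝ θ) y := hDθ.differentiable one_ne_zero y
    rw [FluidPDE.divergence_smul_apply hβd hvd, FluidPDE.inner_gradient_eq_fderiv_apply, hgradθ y]
    have : fderiv ℝ β y (v y) =
        fderiv ℝ θ y (fderiv ℝ v y (v y)) + fderiv ℝ (fderiv ℝ θ) y (v y) (v y) := by
      rw [hβ_def, fderiv_clm_apply hDθd hvd]
      simp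
    rw [this]
    simp only [FluidPDE.convect]
    ring
  -- integrability (continuous integrands supported in `tsupport v`)
  have hWcont : Continuous W := hW.continuous
  have iA : Integrable (fun y => ⟪W y, gradient θ y⟫) :=
    (hWcont.inner (FluidPDE.continuous_gradient_of_contDiff hθ1)).integrable_of_hasCompactSupport
      (HasCompactSupport.intro hK fun y hy => by rw [hW0 y hy, inner_zero_left])
  have iB : Integrable (fun y => fderiv ℝ (fderiv ℝ θ) y (v y) (v y)) :=
    ((((hDθ.continuous_fderiv one_ne_zero).clm_apply hv.continuous).clm_apply
      hv.continuous)).integrable_of_hasCompactSupport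
        (HasCompactSupport.intro hK fun y hy => by simp [hv0 y hy])
  have h3 : ∫ y, VectorCalculus.divergence (fun y => β y • v y) y =
      (∫ y, ⟪W y, gradient θ y⟫) + ∫ y, fderiv ℝ (fderiv ℝ θ) y (v y) (v y) := by
    rw [← integral_add iA iB]
    exact integral_congr_ae (Eventually.of_forall hdivβ)
  have h4 : ∫ y, θ y * pressureSource v y = ∫ y, θ y * VectorCalculus.divergence W y := rfl
  rw [h4]
  linarith [h1, h2, h3]

/-- Translated form: `∫ φ(x - y) G[v](y) dy = ∫ D²φ(x - y)(v y, v y) dy` for `φ ∈ C²`,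
`v ∈ C²_c`. [folklore] -/
theorem integral_comp_sub_mul_pressureSource_of_hasCompactSupport {φ : E → ℝ} {v : E → E}
    (hφ : ContDiff ℝ 2 φ) (hv : ContDiff ℝ 2 v) (hc : HasCompactSupport v) (x : E) :
    ∫ y, φ (x - y) * pressureSource v y = ∫ y, fderiv ℝ (fderiv ℝ φ) (x - y) (v y) (v y) := by
  have hθ : ContDiff ℝ 2 fun y => φ (x - y) := hφ.comp (contDiff_const.sub contDiff_id)
  rw [integral_mul_pressureSource_of_hasCompactSupport hθ hv hc]
  refine integral_congr_ae (Eventually.of_forall fun y => ?_)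
  simp only
  rw [fderiv2_comp_const_sub]

end Source

section R3

-- nested operator types `ℝ³ →L[ℝ] ℝ³ →L[ℝ] ℝ³ →L[ℝ] ℝ`
set_option maxSynthPendingDepth 3

variable {v : (EuclideanSpace ℝ (Fin 3)) → (EuclideanSpace ℝ (Fin 3))} {R : ℝ}

/-! ### Elementary consequences of `supp v ⊆ B̄(0, R)` -/

/-- A field supported in a closed ball has compact support. [folklore] -/
theorem hasCompactSupport_of_tsupport_subset_closedBall (hsupp : tsupport v ⊆ closedBall (0 : (EuclideanSpace ℝ (Fin 3))) R) :
    HasCompactSupport v :=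
  (isCompact_closedBall (0 : (EuclideanSpace ℝ (Fin 3))) R).of_isClosed_subset (isClosed_tsupport v) hsupp

/-- A continuous field supported in a closed ball has finite energy `∫|v|² < ∞`. [folklore] -/
theorem integrable_norm_sq_of_tsupport_subset (hv : Continuous v)
    (hsupp : tsupport v ⊆ closedBall (0 : (EuclideanSpace ℝ (Fin 3))) R) : Integrable fun y => ‖v y‖ ^ 2 :=
  (hv.norm.pow 2).integrable_of_hasCompactSupport
    (HasCompactSupport.intro (hasCompactSupport_of_tsupport_subset_closedBall hsupp) fun y hy => by
      simp [image_eq_zero_of_notMem_tsupport hy])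

/-- Points of the support are far from points outside `B̄(0, R + 2)`:
`2 < |x - y|` whenever `|x| > R + 2`, `y ∈ supp v ⊆ B̄(0,R)`. [folklore] -/
theorem two_lt_norm_sub_of_mem_tsupport (hsupp : tsupport v ⊆ closedBall (0 : (EuclideanSpace ℝ (Fin 3))) R) {x y : (EuclideanSpace ℝ (Fin 3))}
    (hx : R + 2 < ‖x‖) (hy : y ∈ tsupport v) : 2 < ‖x - y‖ := by
  have hy' : ‖y‖ ≤ R := mem_closedBall_zero_iff.1 (hsupp hy)
  have := norm_sub_norm_le x y
  linarith

/-- `|x| - R ≤ |x - y|` for `y ∈ supp v ⊆ B̄(0,R)`. [folklore] -/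
theorem norm_sub_le_norm_sub_of_mem_tsupport (hsupp : tsupport v ⊆ closedBall (0 : (EuclideanSpace ℝ (Fin 3))) R)
    {x y : (EuclideanSpace ℝ (Fin 3))} (hy : y ∈ tsupport v) : ‖x‖ - R ≤ ‖x - y‖ := by
  have hy' : ‖y‖ ≤ R := mem_closedBall_zero_iff.1 (hsupp hy)
  have := norm_sub_norm_le x y
  linarith

/-! ### The near potential vanishes far away; the far potential becomes the plain integral -/

/-- **`Q₁[v](x) = 0` for `|x| > R + 2`**: the `L¹` kernel `Γ₀` (supported in `|z| ≤ 2`) does not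
reach the support of `G[v]` (`⊆ B̄(0,R)`). [folklore] -/
theorem nearPotential_eq_zero_of_lt_norm (hsupp : tsupport v ⊆ closedBall (0 : (EuclideanSpace ℝ (Fin 3))) R) {x : (EuclideanSpace ℝ (Fin 3))}
    (hx : R + 2 < ‖x‖) : nearPotential 1 2 v x = 0 := by
  rw [nearPotential]
  refine integral_eq_zero_of_ae (Eventually.of_forall fun z => ?_)
  simp only [Pi.zero_apply]
  by_cases hz : 2 ≤ ‖z‖
  · rw [newtonNear_eq_zero zero_le_one one_lt_two hz, zero_mul]
  · rw [pressureSource_apply_eq_zero_of_notMem_tsupport, mul_zero]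
    intro hmem
    have h2 := two_lt_norm_sub_of_mem_tsupport hsupp hx hmem
    rw [sub_sub_cancel] at h2
    exact hz h2.le

/-- For `|x| > R + 2` and `y ∈ supp v`, the far kernel at `x - y` is the Newtonian kernel near
`x - y`, so all their derivatives agree there. [folklore] -/
theorem newtonFar_eventuallyEq_newtonKernel_sub (hsupp : tsupport v ⊆ closedBall (0 : (EuclideanSpace ℝ (Fin 3))) R)
    {x y : (EuclideanSpace ℝ (Fin 3))} (hx : R + 2 < ‖x‖) (hy : y ∈ tsupport v) :
    newtonFar 1 2 =ᶠ[𝓝 (x - y)] newtonKernel :=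
  newtonFar_eventuallyEq_newtonKernel zero_le_one one_lt_two
    (two_lt_norm_sub_of_mem_tsupport hsupp hx hy)

/-- **`Q₂[v](x) = -∫ K(x-y)(v y) dy` for `|x| > R + 2`** (`D²Γ∞ = D²Γ = -K` on the relevant
region; off `supp v` both integrands vanish). [folklore] -/
theorem farPotential_eq_neg_integral_pressureKernel (hsupp : tsupport v ⊆ closedBall (0 : (EuclideanSpace ℝ (Fin 3))) R)
    {x : (EuclideanSpace ℝ (Fin 3))} (hx : R + 2 < ‖x‖) :
    farPotential 1 2 v x = -∫ y, pressureKernel (x - y) (v y) := by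
  rw [farPotential, ← integral_neg]
  refine integral_congr_ae (Eventually.of_forall fun y => ?_)
  by_cases hy : y ∈ tsupport v
  · have hxy : x - y ≠ 0 := by
      have := two_lt_norm_sub_of_mem_tsupport hsupp hx hy
      intro h
      rw [h, norm_zero] at this
      linarith
    have e := ((newtonFar_eventuallyEq_newtonKernel_sub hsupp hx hy).fderiv (𝕜 := ℝ)).fderiv
      (𝕜 := ℝ)
    simp only
    rw [e.eq_of_nhds, pressureKernel_eq_neg_fderiv2 hxy, neg_neg]
  · simp only
    rw [image_eq_zero_of_notMem_tsupport hy, map_zero, pressureKernel_zero_right, neg_zero]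

/-- **No principal value far away**: `Q[v](x) = ∫ K(x-y)(v y) dy` for `|x| > R + 2`. [folklore] -/
theorem pressurePotential_eq_integral_pressureKernel (hsupp : tsupport v ⊆ closedBall (0 : (EuclideanSpace ℝ (Fin 3))) R)
    {x : (EuclideanSpace ℝ (Fin 3))} (hx : R + 2 < ‖x‖) :
    pressurePotential v x = ∫ y, pressureKernel (x - y) (v y) := by
  rw [pressurePotential, nearPotential_eq_zero_of_lt_norm hsupp hx,
    farPotential_eq_neg_integral_pressureKernel hsupp hx]
  ring

/-- **The normalised pressure far from the support**: for `v ∈ C²` supported in `B̄(0,R)` and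
`|x| > R + 2`, `p̃[v](x) = ∫ K(x-y)(v y) dy` with the pressure kernel
`K(z)(a) = (3⟨z,a⟩² - |a|²|z|²)/(4π|z|⁵)` (Ożański 2017, §3.2; Tao 2011, (35)). [cite: Ozanski2017NSISingular, §3.2 (3.3)–(3.4)] -/
theorem normalisedPressure_eq_integral_pressureKernel (hv : ContDiff ℝ 2 v)
    (hsupp : tsupport v ⊆ closedBall (0 : (EuclideanSpace ℝ (Fin 3))) R) {x : (EuclideanSpace ℝ (Fin 3))} (hx : R + 2 < ‖x‖) :
    normalisedPressure v x = ∫ y, pressureKernel (x - y) (v y) := by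
  rw [normalisedPressure_eq_pressurePotential hv
    (integrable_norm_sq_of_tsupport_subset hv.continuous hsupp) x,
    pressurePotential_eq_integral_pressureKernel hsupp hx]

/-! ### The global Newtonian representation `p̃[v] = -Γ * G[v]` (Ożański (3.3), Scheffer (1.4)) -/

/-- **The far potential by parts**: for `v ∈ C²_c`, `Q₂[v](x) = ∫ Γ∞(x-y) G[v](y) dy`
(`0 < r₀ < r₁`; two integrations by parts against the smooth kernel `Γ∞`, no boundary terms
since `v` is compactly supported). [folklore] -/
theorem farPotential_eq_integral_newtonFar_mul_pressureSource {r₀ r₁ : ℝ} (h₀ : 0 < r₀)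
    (h₁ : r₀ < r₁) (hv : ContDiff ℝ 2 v) (hc : HasCompactSupport v) (x : (EuclideanSpace ℝ (Fin 3))) :
    farPotential r₀ r₁ v x = ∫ y, newtonFar r₀ r₁ (x - y) * pressureSource v y := by
  rw [farPotential, integral_comp_sub_mul_pressureSource_of_hasCompactSupport
    (contDiff_newtonFar h₀ h₁) hv hc x]

/-- **The near potential, recentred**: `Q₁[v](x) = ∫ Γ₀(x-y) G[v](y) dy` (substitute `z = x - y`
in the defining `∫ Γ₀(z) G[v](x-z) dz`). [folklore] -/
theorem nearPotential_eq_integral_newtonNear_mul_pressureSource (r₀ r₁ : ℝ) (v : (EuclideanSpace ℝ (Fin 3)) → (EuclideanSpace ℝ (Fin 3)))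
    (x : (EuclideanSpace ℝ (Fin 3))) : nearPotential r₀ r₁ v x = ∫ y, newtonNear r₀ r₁ (x - y) * pressureSource v y := by
  rw [nearPotential, ← integral_sub_left_eq_self _ volume x]
  refine integral_congr_ae (Eventually.of_forall fun y => ?_)
  simp only [sub_sub_cancel]

/-- **The pressure potential is the Newtonian potential of the source**:
`Q[v](x) = -∫ Γ(x-y) G[v](y) dy` for `v ∈ C²_c` (`Γ = Γ₀ + Γ∞`). [cite: GilbargTrudinger2001, Lemma 4.2] -/
theorem pressurePotential_eq_neg_integral_newtonKernel_mul_pressureSource (hv : ContDiff ℝ 2 v)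
    (hc : HasCompactSupport v) (x : (EuclideanSpace ℝ (Fin 3))) :
    pressurePotential v x = -∫ y, newtonKernel (x - y) * pressureSource v y := by
  have hG : Continuous (pressureSource v) :=
    (contDiff_pressureSource (n := 0) (by exact_mod_cast hv)).continuous
  have hGc : HasCompactSupport (pressureSource v) :=
    hc.of_isClosed_subset (isClosed_tsupport _) (tsupport_pressureSource_subset v)
  -- integrability of the two pieces
  have i1 : Integrable fun y => newtonNear 1 2 (x - y) * pressureSource v y := by
    have h := (integrable_nearPotential_integrand zero_le_one one_lt_two hv x).comp_sub_left x
    refine h.congr (Eventually.of_forall fun y => ?_)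
    simp only [sub_sub_cancel]
  have i2 : Integrable fun y => newtonFar 1 2 (x - y) * pressureSource v y :=
    (((contDiff_newtonFar one_pos one_lt_two (n := 0)).continuous.comp
      (continuous_const.sub continuous_id)).mul hG).integrable_of_hasCompactSupport hGc.mul_left
  rw [pressurePotential, nearPotential_eq_integral_newtonNear_mul_pressureSource,
    farPotential_eq_integral_newtonFar_mul_pressureSource one_pos one_lt_two hv hc,
    show ∀ a b : ℝ, -a - b = -(a + b) from fun a b => by ring, ← integral_add i1 i2]
  congr 1
  refine integral_congr_ae (Eventually.of_forall fun y => ?_)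
  simp only
  rw [← newtonNear_add_newtonFar 1 2 (x - y)]
  ring

/-- **The tree's normalised pressure IS the printed pressure function** (Ożański 2017, (3.3):
`p(x) = ∫ Σᵢⱼ ∂ᵢuⱼ(y)∂ⱼuᵢ(y)/(4π|x-y|) dy`; Scheffer 1985, (1.4); Tao 2011, (35)): for
`v ∈ C²_c(ℝ³; ℝ³)` and every `x`,
`p̃[v](x) = ∫ G[v](y)/(4π|x-y|) dy`, `G[v] = ∂ᵢ∂ⱼ(vᵢvⱼ) = pressureSource v`
(`= Σᵢⱼ ∂ᵢvⱼ∂ⱼvᵢ` when `div v = 0`, `pressureSource_eq_of_isDivFree`). [cite: Ozanski2017NSISingular, §3.2 (3.3)] -/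
theorem normalisedPressure_eq_integral_newton (hv : ContDiff ℝ 2 v) (hc : HasCompactSupport v)
    (x : (EuclideanSpace ℝ (Fin 3))) :
    normalisedPressure v x = ∫ y, (4 * π * ‖x - y‖)⁻¹ * pressureSource v y := by
  have hL2 : Integrable fun y => ‖v y‖ ^ 2 :=
    (hv.continuous.norm.pow 2).integrable_of_hasCompactSupport
      (HasCompactSupport.intro (K := tsupport v) hc fun y hy => by
        simp [image_eq_zero_of_notMem_tsupport hy])
  rw [normalisedPressure_eq_pressurePotential hv hL2 x,
    pressurePotential_eq_neg_integral_newtonKernel_mul_pressureSource hv hc x, ← integral_neg]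
  refine integral_congr_ae (Eventually.of_forall fun y => ?_)
  simp only [newtonKernel_eq]
  ring

/-! ### Decay of the pressure: `|p̃[v](x)| ≤ ‖v‖₂²/(π(|x|-R)³)` -/

/-- **Far-field bound for the kernel integral**: for `v` continuous and supported in `B̄(0,R)`
and `|x| > R`, `|∫ K(x-y)(v y) dy| ≤ ‖v‖₂²/(π(|x|-R)³)` (`|K(z)(a)| ≤ |a|²/(π|z|³)` and
`|x - y| ≥ |x| - R` on the support). [folklore] -/
theorem abs_integral_pressureKernel_le (hv : Continuous v)
    (hsupp : tsupport v ⊆ closedBall (0 : (EuclideanSpace ℝ (Fin 3))) R) {x : (EuclideanSpace ℝ (Fin 3))} (hx : R < ‖x‖) :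
    |∫ y, pressureKernel (x - y) (v y)| ≤ (∫ y, ‖v y‖ ^ 2) / (π * (‖x‖ - R) ^ 3) := by
  have hd : 0 < ‖x‖ - R := sub_pos.2 hx
  have hL2 := integrable_norm_sq_of_tsupport_subset hv hsupp
  rw [← Real.norm_eq_abs, div_eq_inv_mul, ← integral_const_mul]
  refine norm_integral_le_of_norm_le (hL2.const_mul _) (Eventually.of_forall fun y => ?_)
  rw [Real.norm_eq_abs]
  by_cases hy : y ∈ tsupport v
  · have hxy : ‖x‖ - R ≤ ‖x - y‖ := norm_sub_le_norm_sub_of_mem_tsupport hsupp hy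
    have hxy0 : 0 < ‖x - y‖ := hd.trans_le hxy
    calc |pressureKernel (x - y) (v y)| = |pressureForm (x - y) (v y) (v y)| := by
          rw [pressureKernel_eq_pressureForm]
      _ ≤ ‖v y‖ * ‖v y‖ / (π * ‖x - y‖ ^ 3) := abs_pressureForm_le _ _ _
      _ ≤ ‖v y‖ * ‖v y‖ / (π * (‖x‖ - R) ^ 3) := by
          gcongr
      _ = (π * (‖x‖ - R) ^ 3)⁻¹ * ‖v y‖ ^ 2 := by ring
  · rw [image_eq_zero_of_notMem_tsupport hy, pressureKernel_zero_right, abs_zero]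
    positivity

/-- **Decay of the normalised pressure of a compactly supported field**: for `v ∈ C²` supported
in `B̄(0,R)` and `|x| > R + 2`, `|p̃[v](x)| ≤ ‖v‖₂²/(π(|x|-R)³)` — the `|x|⁻³` decay behind
Ożański 2017, (3.4) (whose printed form is for `∇p` and `D²p`). [cite: Ozanski2017NSISingular, §3.2 (3.4)] -/
theorem abs_normalisedPressure_le_of_lt_norm (hv : ContDiff ℝ 2 v)
    (hsupp : tsupport v ⊆ closedBall (0 : (EuclideanSpace ℝ (Fin 3))) R) {x : (EuclideanSpace ℝ (Fin 3))} (hx : R + 2 < ‖x‖) :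
    |normalisedPressure v x| ≤ (∫ y, ‖v y‖ ^ 2) / (π * (‖x‖ - R) ^ 3) := by
  rw [normalisedPressure_eq_integral_pressureKernel hv hsupp hx]
  exact abs_integral_pressureKernel_le hv.continuous hsupp (by linarith)

/-! ### The gradient far from the support and its `|x|⁻⁴` decay (Ożański (3.4)) -/

/-- **Differentiating the far potential under the integral sign**:
`∂ₐQ₂[v](x) = ∫ D³Γ∞(x-y)(a, v y, v y) dy` (`0 < r₀ < r₁`; bounded smooth kernel against the
integrable weights `v ⊗ v`). [folklore] -/
theorem fderiv_farPotential_apply {r₀ r₁ : ℝ} (h₀ : 0 < r₀) (h₁ : r₀ < r₁) (hv : Continuous v)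
    (hL2 : Integrable fun y => ‖v y‖ ^ 2) (x a : (EuclideanSpace ℝ (Fin 3))) :
    fderiv ℝ (farPotential r₀ r₁ v) x a =
      ∫ y, fderiv ℝ (fderiv ℝ (fderiv ℝ (newtonFar r₀ r₁))) (x - y) a (v y) (v y) := by
  obtain ⟨M₀, M₁, -, hM₀, hM₁, -⟩ := exists_bounds_fderiv2_newtonFar h₀ h₁
  have hΦ : ContDiff ℝ 1 (fderiv ℝ (fderiv ℝ (newtonFar r₀ r₁))) :=
    (contDiff_fderiv2_newtonFar h₀ h₁).of_le one_le_two
  rw [farPotential_eq, fderiv_integral_clm_apply_comp_sub_apply (L := fun y => evalDiag (v y)) hΦ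
    hM₀ hM₁ (continuous_evalDiag.comp hv) (integrable_evalDiag_comp hv hL2) x a]
  rfl

/-- **The near potential is locally constant (zero) far away**: `Q₁[v] = 0` on the open set
`{|x| > R + 2}`, hence `DQ₁[v](x) = 0` there. [folklore] -/
theorem nearPotential_eventuallyEq_zero_of_lt_norm (hsupp : tsupport v ⊆ closedBall (0 : (EuclideanSpace ℝ (Fin 3))) R)
    {x : (EuclideanSpace ℝ (Fin 3))} (hx : R + 2 < ‖x‖) : nearPotential 1 2 v =ᶠ[𝓝 x] fun _ => 0 := by
  have hopen : IsOpen {x : (EuclideanSpace ℝ (Fin 3)) | R + 2 < ‖x‖} := isOpen_lt continuous_const continuous_norm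
  filter_upwards [hopen.mem_nhds hx] with w hw
  exact nearPotential_eq_zero_of_lt_norm hsupp hw

/-- **The gradient of the pressure potential far away**: for `v` continuous, supported in
`B̄(0,R)`, and `|x| > R + 2`, `∂ₐQ[v](x) = -∫ D³Γ(x-y)(a, v y, v y) dy`. [folklore] -/
theorem fderiv_pressurePotential_apply_of_lt_norm (hv : Continuous v)
    (hsupp : tsupport v ⊆ closedBall (0 : (EuclideanSpace ℝ (Fin 3))) R) {x : (EuclideanSpace ℝ (Fin 3))} (hx : R + 2 < ‖x‖) (a : (EuclideanSpace ℝ (Fin 3))) :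
    fderiv ℝ (pressurePotential v) x a =
      -∫ y, fderiv ℝ (fderiv ℝ (fderiv ℝ newtonKernel)) (x - y) a (v y) (v y) := by
  have hL2 := integrable_norm_sq_of_tsupport_subset hv hsupp
  -- `Q[v] = -Q₂[v]` near `x`
  have hP : pressurePotential v =ᶠ[𝓝 x] fun w => -farPotential 1 2 v w := by
    filter_upwards [nearPotential_eventuallyEq_zero_of_lt_norm hsupp hx] with w hw
    rw [pressurePotential, hw]
    ring
  rw [hP.fderiv_eq, show (fun w => -farPotential 1 2 v w) = -farPotential 1 2 v from rfl,
    fderiv_neg, _root_.FunLike.coe_neg, Pi.neg_apply,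
    fderiv_farPotential_apply one_pos one_lt_two hv hL2 x a, ← integral_neg, ← integral_neg]
  refine integral_congr_ae (Eventually.of_forall fun y => ?_)
  simp only
  by_cases hy : y ∈ tsupport v
  · have e := (((newtonFar_eventuallyEq_newtonKernel_sub hsupp hx hy).fderiv (𝕜 := ℝ)).fderiv
      (𝕜 := ℝ)).fderiv (𝕜 := ℝ)
    rw [e.eq_of_nhds]
  · simp [image_eq_zero_of_notMem_tsupport hy]

/-- **The gradient of the normalised pressure far from the support** (the formula behind
Ożański 2017, (3.4) and Lemma 7): for `v ∈ C²` supported in `B̄(0,R)` and `|x| > R + 2`,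
`∂ₐp̃[v](x) = -∫ D³Γ(x-y)(a, v y, v y) dy`, `Γ(z) = -1/(4π|z|)`. [cite: Ozanski2017NSISingular, §3.2 (3.4)] -/
theorem fderiv_normalisedPressure_apply_of_lt_norm (hv : ContDiff ℝ 2 v)
    (hsupp : tsupport v ⊆ closedBall (0 : (EuclideanSpace ℝ (Fin 3))) R) {x : (EuclideanSpace ℝ (Fin 3))} (hx : R + 2 < ‖x‖) (a : (EuclideanSpace ℝ (Fin 3))) :
    fderiv ℝ (normalisedPressure v) x a =
      -∫ y, fderiv ℝ (fderiv ℝ (fderiv ℝ newtonKernel)) (x - y) a (v y) (v y) := by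
  rw [normalisedPressure_eq_pressurePotential' hv
    (integrable_norm_sq_of_tsupport_subset hv.continuous hsupp)]
  exact fderiv_pressurePotential_apply_of_lt_norm hv.continuous hsupp hx a

/-- **Decay of the pressure gradient** (Ożański 2017, (3.4), first half: `|∇p| ≤ C|x|⁻⁴`): for
`v ∈ C²` supported in `B̄(0,R)`, `|x| > R + 2`, and any constant `C ≥ 0` with
`|D³Γ(z)| ≤ C/|z|⁴`, `‖∇p̃[v](x)‖ ≤ C ‖v‖₂²/(|x|-R)⁴`. [cite: Ozanski2017NSISingular, §3.2 (3.4)] -/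
theorem norm_fderiv_normalisedPressure_le_of_lt_norm (hv : ContDiff ℝ 2 v)
    (hsupp : tsupport v ⊆ closedBall (0 : (EuclideanSpace ℝ (Fin 3))) R) {x : (EuclideanSpace ℝ (Fin 3))} (hx : R + 2 < ‖x‖) {C : ℝ}
    (hC0 : 0 ≤ C)
    (hC : ∀ z : (EuclideanSpace ℝ (Fin 3)), z ≠ 0 → ‖fderiv ℝ (fderiv ℝ (fderiv ℝ newtonKernel)) z‖ ≤ C / ‖z‖ ^ 4) :
    ‖fderiv ℝ (normalisedPressure v) x‖ ≤ C * (∫ y, ‖v y‖ ^ 2) / (‖x‖ - R) ^ 4 := by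
  have hd : 0 < ‖x‖ - R := by linarith
  have hL2 := integrable_norm_sq_of_tsupport_subset hv.continuous hsupp
  have hE0 : 0 ≤ ∫ y, ‖v y‖ ^ 2 := integral_nonneg fun y => sq_nonneg _
  have hd4 : 0 < (‖x‖ - R) ^ 4 := pow_pos hd 4
  refine ContinuousLinearMap.opNorm_le_bound _ (div_nonneg (mul_nonneg hC0 hE0) hd4.le)
    fun a => ?_
  have hconst : C * (∫ y, ‖v y‖ ^ 2) / (‖x‖ - R) ^ 4 * ‖a‖ =
      ∫ y, C / (‖x‖ - R) ^ 4 * ‖a‖ * ‖v y‖ ^ 2 := by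
    rw [integral_const_mul]
    ring
  rw [fderiv_normalisedPressure_apply_of_lt_norm hv hsupp hx a, norm_neg, hconst]
  refine norm_integral_le_of_norm_le ((hL2.const_mul _)) (Eventually.of_forall fun y => ?_)
  by_cases hy : y ∈ tsupport v
  · have hxy : ‖x‖ - R ≤ ‖x - y‖ := norm_sub_le_norm_sub_of_mem_tsupport hsupp hy
    have hxy0 : x - y ≠ 0 := by
      intro h; rw [h, norm_zero] at hxy; linarith
    calc ‖fderiv ℝ (fderiv ℝ (fderiv ℝ newtonKernel)) (x - y) a (v y) (v y)‖
        ≤ ‖fderiv ℝ (fderiv ℝ (fderiv ℝ newtonKernel)) (x - y) a (v y)‖ * ‖v y‖ :=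
          ContinuousLinearMap.le_opNorm _ _
      _ ≤ ‖fderiv ℝ (fderiv ℝ (fderiv ℝ newtonKernel)) (x - y) a‖ * ‖v y‖ * ‖v y‖ := by
          gcongr; exact ContinuousLinearMap.le_opNorm _ _
      _ ≤ ‖fderiv ℝ (fderiv ℝ (fderiv ℝ newtonKernel)) (x - y)‖ * ‖a‖ * ‖v y‖ * ‖v y‖ := by
          gcongr; exact ContinuousLinearMap.le_opNorm _ _
      _ ≤ C / ‖x - y‖ ^ 4 * ‖a‖ * ‖v y‖ * ‖v y‖ := by gcongr; exact hC _ hxy0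
      _ ≤ C / (‖x‖ - R) ^ 4 * ‖a‖ * ‖v y‖ * ‖v y‖ := by gcongr
      _ = C / (‖x‖ - R) ^ 4 * ‖a‖ * ‖v y‖ ^ 2 := by ring
  · rw [image_eq_zero_of_notMem_tsupport hy]
    simp only [map_zero, norm_zero]
    positivity

/-- **Decay of the pressure gradient, packaged** (Ożański 2017, (3.4)): there is an absolute
constant `C ≥ 0` such that for every `v ∈ C²(ℝ³; ℝ³)` supported in `B̄(0,R)` and every
`|x| > R + 2`, `‖∇p̃[v](x)‖ ≤ C ‖v‖₂²/(|x|-R)⁴`. [cite: Ozanski2017NSISingular, §3.2 (3.4)] -/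
theorem exists_norm_fderiv_normalisedPressure_le :
    ∃ C : ℝ, 0 ≤ C ∧ ∀ (v : (EuclideanSpace ℝ (Fin 3)) → (EuclideanSpace ℝ (Fin 3))) (R : ℝ) (x : (EuclideanSpace ℝ (Fin 3))), ContDiff ℝ 2 v →
      tsupport v ⊆ closedBall (0 : (EuclideanSpace ℝ (Fin 3))) R → R + 2 < ‖x‖ →
        ‖fderiv ℝ (normalisedPressure v) x‖ ≤ C * (∫ y, ‖v y‖ ^ 2) / (‖x‖ - R) ^ 4 := by
  obtain ⟨C, hC0, hC⟩ := exists_norm_fderiv3_newtonKernel_le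
  exact ⟨C, hC0, fun v R x hv hsupp hx =>
    norm_fderiv_normalisedPressure_le_of_lt_norm hv hsupp hx hC0 hC⟩

end R3

end Literature.Analysis.FluidPDE

end
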